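import Mathlib.Algebra.Ring.Periodic
import Literature.Dynamics.Hyperbolic.SequenceShadowingUniqueness

/-!
# Shadowing for a sequence of maps of a Banach space, V: periodic data and the `ℓ¹` bound over a period

For `p`-PERIODIC hyperbolic sequences and maps (`A_{k+p} = A_k`, `φ_{k+p} = φ_k`) the Green operator of
`SequenceShadowingGreen` is bounded by the same constant `N₁ = N(1+λ)/(1-λ)` in the `ℓ¹`-NORM OVER A
PERIOD, `∑_{k<p} ‖(𝒢 z)_k‖ ≤ N₁ ∑_{k<p} ‖z_k‖` (`IsHyperbolicSequence.sum_norm_green_le`; this is the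
instance `𝓑 = ℓ¹` over a period of S. Yu. Pilyugin, LNM 1706 (1999), Lemma 1.3.1, which is stated for any
monotone sequence norm dominating `ℓ_∞`), and consequently the unique `p`-periodic shadow of
`SequenceShadowingUniqueness` obeys the a-posteriori bound
`∑_{k<p} ‖v_k‖ ≤ L ∑_{k<p} ‖φ_k(0)‖`, `L = N₁/(1-κN₁)` (`IsHyperbolicSequence.sum_norm_periodic_shadow_le`),
UNIFORMLY IN THE PERIOD `p`.  This is what closing lemmas for FLOWS need: when a returning orbit segment
of length `n` is encoded in charts on transversals as an `n`-periodic hyperbolic sequence whose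
pseudo-orbit error is concentrated at the return, the accumulated phase drift of the closed orbit and its
equal-time distance to the reference segment are controlled by `∑_{k<n} ‖v_k‖ = O(δ)`, not by
`n · sup_k ‖v_k‖`.  Auxiliary: shift invariance of sums over a period (`sum_range_shift_of_periodic`).
Fully proved.

## References

* S. Yu. Pilyugin, *Shadowing in Dynamical Systems*, LNM 1706 (1999), §1.3.1, Lemma 1.3.1. [Pilyugin1999]
-/

noncomputable section

open Filter Set Function
open scoped Topology NNReal

namespace Literature.Dynamics.Hyperbolic

variable {E : Type*} [NormedAddCommGroup E] [NormedSpace ℝ E]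

/-- Sums over a period are invariant under the unit shift (`p`-periodic `f : ℤ → ℝ`). [folklore] -/
theorem _root_.Literature.Dynamics.Hyperbolic.sum_range_shift_one_of_periodic {f : ℤ → ℝ} {p : ℕ}
    (hf : ∀ k : ℤ, f (k + p) = f k) :
    ∑ k ∈ Finset.range p, f (k + 1) = ∑ k ∈ Finset.range p, f k := by
  have e1 := Finset.sum_range_succ' (fun k : ℕ => f (k : ℤ)) p
  have e2 := Finset.sum_range_succ (fun k : ℕ => f (k : ℤ)) p
  have e3 : f (p : ℤ) = f ((0 : ℕ) : ℤ) := by simpa using hf 0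
  push_cast at e1 e2 e3 ⊢
  linarith

/-- Sums over a period are invariant under natural shifts. [folklore] -/
theorem _root_.Literature.Dynamics.Hyperbolic.sum_range_shift_nat_of_periodic {f : ℤ → ℝ} {p : ℕ}
    (hf : ∀ k : ℤ, f (k + p) = f k) (j : ℕ) :
    ∑ k ∈ Finset.range p, f (k + j) = ∑ k ∈ Finset.range p, f k := by
  induction j with
  | zero => simp
  | succ j ih =>
    have hg : ∀ k : ℤ, (fun k : ℤ => f (k + j)) (k + p) = (fun k : ℤ => f (k + j)) k := fun k => by
      show f (k + p + j) = f (k + j)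
      rw [add_right_comm]; exact hf (k + j)
    have h1 := sum_range_shift_one_of_periodic (f := fun k : ℤ => f (k + j)) hg
    calc ∑ k ∈ Finset.range p, f (k + ((j + 1 : ℕ) : ℤ)) = ∑ k ∈ Finset.range p, f ((k : ℤ) + 1 + j) := by
          refine Finset.sum_congr rfl fun k _ => ?_
          congr 1; push_cast; ring
      _ = ∑ k ∈ Finset.range p, f (k + j) := h1
      _ = ∑ k ∈ Finset.range p, f k := ih

/-- **Shift invariance of sums over a period**: for a `p`-periodic `f : ℤ → ℝ` and any `j : ℤ`,
`∑_{k<p} f (k + j) = ∑_{k<p} f k`. [folklore] -/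
theorem _root_.Literature.Dynamics.Hyperbolic.sum_range_shift_of_periodic {f : ℤ → ℝ} {p : ℕ}
    (hf : ∀ k : ℤ, f (k + p) = f k) (j : ℤ) :
    ∑ k ∈ Finset.range p, f (k + j) = ∑ k ∈ Finset.range p, f k := by
  rcases Nat.eq_zero_or_pos p with hp | hp
  · subst hp; simp
  have hper : Function.Periodic f (p : ℤ) := hf
  have hp0 : (p : ℤ) ≠ 0 := by exact_mod_cast hp.ne'
  set r : ℤ := j % (p : ℤ) with hr
  have hr0 : 0 ≤ r := Int.emod_nonneg _ hp0
  have hj : j = r + (p : ℤ) * (j / p) := by rw [hr, Int.emod_def]; ring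
  have key : ∀ k : ℤ, f (k + j) = f (k + (r.toNat : ℕ)) := by
    intro k
    rw [Int.toNat_of_nonneg hr0, hj, show k + (r + (p : ℤ) * (j / p)) = (k + r) + (j / p) * p by ring]
    exact hper.int_mul (j / p) (k + r)
  simp only [key]
  exact sum_range_shift_nat_of_periodic hf r.toNat

namespace IsHyperbolicSequence

variable {A P B : ℤ → E →L[ℝ] E} {lam N : ℝ}

/-- Pointwise bound of the stable term: `‖A_{n-1}⋯P z_{n-m-1}‖ ≤ N λ^{m+1} ‖z_{n-m-1}‖`. [folklore] -/
theorem norm_stableTerm_le_pointwise (h : IsHyperbolicSequence A P B lam N) (z : ℤ → E) (n : ℤ) (m : ℕ) :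
    ‖stableTerm A P z n m‖ ≤ N * lam ^ (m + 1) * ‖z (n - (m + 1 : ℕ))‖ := by
  unfold stableTerm
  have hmem : P (n - (m + 1 : ℕ)) (z (n - (m + 1 : ℕ))) ∈ stableSpace P (n - (m + 1 : ℕ)) :=
    apply_mem_stableSpace P _ _
  have h1 := (h.stableChain_apply (m + 1) n _ (by exact_mod_cast hmem)).1
  refine h1.trans ?_
  have h2 := h.norm_P_apply_le (n - (m + 1 : ℕ)) (z (n - (m + 1 : ℕ)))
  calc lam ^ (m + 1) * ‖P (n - (m + 1 : ℕ)) (z (n - (m + 1 : ℕ)))‖ ≤ lam ^ (m + 1) * (N * ‖z (n - (m + 1 : ℕ))‖) :=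
        mul_le_mul_of_nonneg_left h2 (pow_nonneg h.lam_nonneg _)
    _ = N * lam ^ (m + 1) * ‖z (n - (m + 1 : ℕ))‖ := by ring

/-- Pointwise bound of the unstable term: `‖B_n⋯B_{n+m} Q z_{n+m+1}‖ ≤ N λ^{m+1} ‖z_{n+m+1}‖`. [folklore] -/
theorem norm_unstableTerm_le_pointwise (h : IsHyperbolicSequence A P B lam N) (z : ℤ → E) (n : ℤ) (m : ℕ) :
    ‖unstableTerm P B z n m‖ ≤ N * lam ^ (m + 1) * ‖z (n + m + 1)‖ := by
  unfold unstableTerm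
  have h1 := (h.unstableChain_apply m n _ (apply_mem_unstableSpace P (n + m + 1) (z (n + m + 1)))).1
  refine h1.trans ?_
  have h2 := h.norm_Q_apply_le (n + m + 1) (z (n + m + 1))
  calc lam ^ (m + 1) * ‖((1 : E →L[ℝ] E) - P (n + m + 1)) (z (n + m + 1))‖ ≤ lam ^ (m + 1) * (N * ‖z (n + m + 1)‖) :=
        mul_le_mul_of_nonneg_left h2 (pow_nonneg h.lam_nonneg _)
    _ = N * lam ^ (m + 1) * ‖z (n + m + 1)‖ := by ring

/-- Pointwise `ℓ¹`-type bound of the Green operator: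
`‖(𝒢z)_k‖ ≤ N‖z_k‖ + ∑_m Nλ^{m+1} ‖z_{k-m-1}‖ + ∑_m Nλ^{m+1} ‖z_{k+m+1}‖` (bounded `z`). [folklore] -/
theorem norm_green_le_pointwise (h : IsHyperbolicSequence A P B lam N) {z : ℤ → E} {C : ℝ}
    (hz : ∀ k, ‖z k‖ ≤ C) (k : ℤ) :
    ‖green A P B z k‖ ≤ N * ‖z k‖ + ∑' m : ℕ, N * lam ^ (m + 1) * ‖z (k - (m + 1 : ℕ))‖ +
      ∑' m : ℕ, N * lam ^ (m + 1) * ‖z (k + m + 1)‖ := by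
  have hmaj := (h.hasSum_majorant C).summable
  have hs1 : Summable fun m : ℕ => N * lam ^ (m + 1) * ‖z (k - (m + 1 : ℕ))‖ := by
    refine Summable.of_nonneg_of_le (fun m => by have := h.N_nonneg; have := h.lam_nonneg; positivity)
      (fun m => ?_) hmaj
    calc N * lam ^ (m + 1) * ‖z (k - (m + 1 : ℕ))‖ ≤ N * lam ^ (m + 1) * C := by
          have := h.N_nonneg; have := h.lam_nonneg; gcongr; exact hz _
      _ = N * C * lam ^ (m + 1) := by ring
  have hs2 : Summable fun m : ℕ => N * lam ^ (m + 1) * ‖z (k + m + 1)‖ := by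
    refine Summable.of_nonneg_of_le (fun m => by have := h.N_nonneg; have := h.lam_nonneg; positivity)
      (fun m => ?_) hmaj
    calc N * lam ^ (m + 1) * ‖z (k + m + 1)‖ ≤ N * lam ^ (m + 1) * C := by
          have := h.N_nonneg; have := h.lam_nonneg; gcongr; exact hz _
      _ = N * C * lam ^ (m + 1) := by ring
  have e1 : ‖∑' m : ℕ, stableTerm A P z k m‖ ≤ ∑' m : ℕ, N * lam ^ (m + 1) * ‖z (k - (m + 1 : ℕ))‖ := by
    refine (norm_tsum_le_tsum_norm ?_).trans ?_
    · exact Summable.of_nonneg_of_le (fun _ => norm_nonneg _) (h.norm_stableTerm_le_pointwise z k) hs1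
    · exact Summable.tsum_le_tsum (h.norm_stableTerm_le_pointwise z k)
        (Summable.of_nonneg_of_le (fun _ => norm_nonneg _) (h.norm_stableTerm_le_pointwise z k) hs1) hs1
  have e2 : ‖∑' m : ℕ, unstableTerm P B z k m‖ ≤ ∑' m : ℕ, N * lam ^ (m + 1) * ‖z (k + m + 1)‖ := by
    refine (norm_tsum_le_tsum_norm ?_).trans ?_
    · exact Summable.of_nonneg_of_le (fun _ => norm_nonneg _) (h.norm_unstableTerm_le_pointwise z k) hs2
    · exact Summable.tsum_le_tsum (h.norm_unstableTerm_le_pointwise z k)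
        (Summable.of_nonneg_of_le (fun _ => norm_nonneg _) (h.norm_unstableTerm_le_pointwise z k) hs2) hs2
  have e0 : ‖P k (z k)‖ ≤ N * ‖z k‖ := h.norm_P_apply_le k (z k)
  unfold green
  have t1 := norm_sub_le (P k (z k) + ∑' m : ℕ, stableTerm A P z k m) (∑' m : ℕ, unstableTerm P B z k m)
  have t2 := norm_add_le (P k (z k)) (∑' m : ℕ, stableTerm A P z k m)
  linarith

/-- **`ℓ¹`-over-a-period bound of the Green operator**: for bounded `p`-periodic `z`,
`∑_{k<p} ‖(𝒢 z)_k‖ ≤ N₁ ∑_{k<p} ‖z_k‖` (the `ℓ¹` instance of Pilyugin's Lemma 1.3.1 (a1)). [cite: Pilyugin1999, Lemma 1.3.1 with 𝓑 = ℓ¹ over a period] -/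
theorem sum_norm_green_le (h : IsHyperbolicSequence A P B lam N) {z : ℤ → E} {C : ℝ}
    (hz : ∀ k, ‖z k‖ ≤ C) {p : ℕ} (hper : ∀ k : ℤ, z (k + p) = z k) :
    ∑ k ∈ Finset.range p, ‖green A P B z k‖ ≤ greenBound lam N * ∑ k ∈ Finset.range p, ‖z k‖ := by
  set Z : ℝ := ∑ k ∈ Finset.range p, ‖z k‖ with hZ
  have hNn := h.N_nonneg
  have hl := h.lam_nonneg
  have hmaj := (h.hasSum_majorant C).summable
  have hnper : ∀ k : ℤ, ‖z (k + p)‖ = ‖z k‖ := fun k => by rw [hper]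
  -- summability of the two majorant families, for each `k`
  have hs1 : ∀ k : ℤ, Summable fun m : ℕ => N * lam ^ (m + 1) * ‖z (k - (m + 1 : ℕ))‖ := fun k => by
    refine Summable.of_nonneg_of_le (fun m => by positivity) (fun m => ?_) hmaj
    calc N * lam ^ (m + 1) * ‖z (k - (m + 1 : ℕ))‖ ≤ N * lam ^ (m + 1) * C := by gcongr; exact hz _
      _ = N * C * lam ^ (m + 1) := by ring
  have hs2 : ∀ k : ℤ, Summable fun m : ℕ => N * lam ^ (m + 1) * ‖z (k + m + 1)‖ := fun k => by
    refine Summable.of_nonneg_of_le (fun m => by positivity) (fun m => ?_) hmaj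
    calc N * lam ^ (m + 1) * ‖z (k + m + 1)‖ ≤ N * lam ^ (m + 1) * C := by gcongr; exact hz _
      _ = N * C * lam ^ (m + 1) := by ring
  -- sum the pointwise bound over a period and swap the sums
  have step1 : ∑ k ∈ Finset.range p, ‖green A P B z k‖ ≤
      ∑ k ∈ Finset.range p, (N * ‖z k‖ + ∑' m : ℕ, N * lam ^ (m + 1) * ‖z (k - (m + 1 : ℕ))‖ +
        ∑' m : ℕ, N * lam ^ (m + 1) * ‖z (k + m + 1)‖) :=
    Finset.sum_le_sum fun k _ => h.norm_green_le_pointwise hz k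
  have swap1 : ∑ k ∈ Finset.range p, ∑' m : ℕ, N * lam ^ (m + 1) * ‖z (k - (m + 1 : ℕ))‖ =
      ∑' m : ℕ, N * lam ^ (m + 1) * Z := by
    rw [← Summable.tsum_finsetSum (f := fun (k : ℕ) (m : ℕ) => N * lam ^ (m + 1) * ‖z ((k : ℤ) - (m + 1 : ℕ))‖)
      (s := Finset.range p) (fun k _ => hs1 k)]
    refine tsum_congr fun m => ?_
    rw [hZ, Finset.mul_sum]
    have := sum_range_shift_of_periodic (f := fun k : ℤ => N * lam ^ (m + 1) * ‖z k‖) (p := p)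
      (fun k => by simp only [hnper]) (-((m + 1 : ℕ) : ℤ))
    simpa [sub_eq_add_neg] using this
  have swap2 : ∑ k ∈ Finset.range p, ∑' m : ℕ, N * lam ^ (m + 1) * ‖z (k + m + 1)‖ =
      ∑' m : ℕ, N * lam ^ (m + 1) * Z := by
    rw [← Summable.tsum_finsetSum (f := fun (k : ℕ) (m : ℕ) => N * lam ^ (m + 1) * ‖z ((k : ℤ) + m + 1)‖)
      (s := Finset.range p) (fun k _ => hs2 k)]
    refine tsum_congr fun m => ?_
    rw [hZ, Finset.mul_sum]
    have := sum_range_shift_of_periodic (f := fun k : ℤ => N * lam ^ (m + 1) * ‖z k‖) (p := p)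
      (fun k => by simp only [hnper]) ((m : ℤ) + 1)
    simpa [add_assoc] using this
  have hgeo : ∑' m : ℕ, N * lam ^ (m + 1) * Z = N * Z * (lam / (1 - lam)) := by
    have := (h.hasSum_majorant Z).tsum_eq
    simpa [mul_comm, mul_left_comm, mul_assoc] using this
  rw [Finset.sum_add_distrib, Finset.sum_add_distrib, swap1, swap2, hgeo, ← Finset.mul_sum] at step1
  have h1l := h.one_sub_lam_pos
  unfold greenBound
  calc ∑ k ∈ Finset.range p, ‖green A P B z k‖ ≤ N * Z + N * Z * (lam / (1 - lam)) + N * Z * (lam / (1 - lam)) := step1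
    _ = N * (1 + lam) / (1 - lam) * Z := by field_simp; ring

variable [CompleteSpace E]

/-- **`ℓ¹` BOUND OF THE PERIODIC SHADOW OVER A PERIOD.**  Under (a), (b), (b') and `κN₁ < 1`, for
`p`-periodic linear parts `A_{k+p} = A_k` and maps `φ_{k+p} = φ_k`, every `p`-periodic trajectory of `φ` in
the `Δ`-ball satisfies `∑_{k<p} ‖v_k‖ ≤ L ∑_{k<p} ‖φ_k(0)‖`, `L = N₁/(1-κN₁)`: the total size of the shadow
over a period is controlled by the total pseudo-orbit error over a period, uniformly in `p`. [folklore] -/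
theorem sum_norm_periodic_shadow_le (h : IsHyperbolicSequence A P B lam N)
    (hU : ∀ (k : ℤ), ∀ v ∈ unstableSpace P k, A k v ∈ unstableSpace P (k + 1))
    (hexp : ∀ (k : ℤ), ∀ v ∈ unstableSpace P k, ‖v‖ ≤ lam * ‖A k v‖)
    {φ : ℤ → E → E} {κ Δ d : ℝ} (hκ : 0 ≤ κ) (hκN : κ * greenBound lam N < 1)
    (hLip : ∀ (k : ℤ) (v v' : E), ‖v‖ ≤ Δ → ‖v'‖ ≤ Δ →
      ‖(φ k v - A k v) - (φ k v' - A k v')‖ ≤ κ * ‖v - v'‖)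
    (hφ0 : ∀ k, ‖φ k 0‖ ≤ d) {p : ℕ} (hAper : ∀ k : ℤ, A (k + p) = A k) (hφper : ∀ k : ℤ, φ (k + p) = φ k)
    {v : ℤ → E} (hv : ∀ k, ‖v k‖ ≤ Δ) (htraj : ∀ k, φ k (v k) = v (k + 1)) (hvper : ∀ k : ℤ, v (k + p) = v k) :
    ∑ k ∈ Finset.range p, ‖v k‖ ≤ shadowConst lam N κ * ∑ k ∈ Finset.range p, ‖φ k 0‖ := by
  have hΔ : 0 ≤ Δ := (norm_nonneg _).trans (hv 0)
  set g : ℤ → E := fun k => φ (k - 1) (v (k - 1)) - A (k - 1) (v (k - 1)) with hg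
  have hvG := h.eq_green_of_trajectory hU hexp hκ hLip hφ0 hv htraj
  have hgb : ∀ k, ‖g k‖ ≤ d + κ * Δ := fun k => norm_nonlin_le hκ hLip hφ0 (k - 1) (hv _)
  have hgper : ∀ k : ℤ, g (k + p) = g k := by
    intro k
    simp only [hg]
    rw [show k + (p : ℤ) - 1 = (k - 1) + p by ring, hφper, hvper, hAper]
  -- pointwise: ‖g k‖ ≤ ‖φ_{k-1} 0‖ + κ ‖v_{k-1}‖
  have hgpt : ∀ k, ‖g k‖ ≤ ‖φ (k - 1) 0‖ + κ * ‖v (k - 1)‖ := by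
    intro k
    have h1 := hLip (k - 1) (v (k - 1)) 0 (hv _) (by simpa using hΔ)
    simp only [map_zero, sub_zero] at h1
    calc ‖g k‖ = ‖(φ (k - 1) (v (k - 1)) - A (k - 1) (v (k - 1)) - φ (k - 1) 0) + φ (k - 1) 0‖ := by
          simp only [hg, sub_add_cancel]
      _ ≤ ‖φ (k - 1) (v (k - 1)) - A (k - 1) (v (k - 1)) - φ (k - 1) 0‖ + ‖φ (k - 1) 0‖ := norm_add_le _ _
      _ ≤ κ * ‖v (k - 1)‖ + ‖φ (k - 1) 0‖ := add_le_add h1 le_rfl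
      _ = ‖φ (k - 1) 0‖ + κ * ‖v (k - 1)‖ := by ring
  set V : ℝ := ∑ k ∈ Finset.range p, ‖v k‖ with hV
  set Φ : ℝ := ∑ k ∈ Finset.range p, ‖φ k 0‖ with hΦ
  have hvper' : ∀ k : ℤ, ‖v (k + p)‖ = ‖v k‖ := fun k => by rw [hvper]
  have hφper' : ∀ k : ℤ, ‖φ (k + p) 0‖ = ‖φ k 0‖ := fun k => by rw [hφper]
  have hshiftV : ∑ k ∈ Finset.range p, ‖v (k - 1)‖ = V := by
    have := sum_range_shift_of_periodic (f := fun k : ℤ => ‖v k‖) (p := p) hvper' (-1)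
    simpa [sub_eq_add_neg] using this
  have hshiftΦ : ∑ k ∈ Finset.range p, ‖φ (k - 1) 0‖ = Φ := by
    have := sum_range_shift_of_periodic (f := fun k : ℤ => ‖φ k 0‖) (p := p) hφper' (-1)
    simpa [sub_eq_add_neg] using this
  have e1 : V = ∑ k ∈ Finset.range p, ‖green A P B g k‖ := Finset.sum_congr rfl fun k _ => by rw [← hvG k]
  have e2 : ∑ k ∈ Finset.range p, ‖green A P B g k‖ ≤ greenBound lam N * ∑ k ∈ Finset.range p, ‖g k‖ :=
    h.sum_norm_green_le hgb hgper
  have e3 : ∑ k ∈ Finset.range p, ‖g k‖ ≤ Φ + κ * V := by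
    calc ∑ k ∈ Finset.range p, ‖g k‖ ≤ ∑ k ∈ Finset.range p, (‖φ (k - 1) 0‖ + κ * ‖v (k - 1)‖) :=
          Finset.sum_le_sum fun k _ => hgpt k
      _ = Φ + κ * V := by rw [Finset.sum_add_distrib, ← Finset.mul_sum, hshiftΦ, hshiftV]
  have hN₁ := h.greenBound_pos
  have h1κ : 0 < 1 - κ * greenBound lam N := sub_pos.2 hκN
  have key : V * (1 - κ * greenBound lam N) ≤ greenBound lam N * Φ := by
    have := mul_le_mul_of_nonneg_left e3 hN₁.le
    nlinarith
  unfold shadowConst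
  rw [div_mul_eq_mul_div, le_div_iff₀ h1κ]
  linarith

end IsHyperbolicSequence

end Literature.Dynamics.Hyperbolic

end
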